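import Mathlib
import Literature.MathematicalPhysics.QuantumFieldTheory.OSReconstructionNoE1Proofs
import Literature.MathematicalPhysics.QuantumFieldTheory.OSJointSpectralMeasureUniqueness
import HarnessLib

/-!
# Universal two-point measure, II: the joint spectral measure of a superposed vector
(line `complex-rotation-bandlimit`)

Support file for crux `stmt-QuantumFields-11686` (`PencilRigidity.NPointIsotropy`), stub
`universalTwoPointMeasure`. Setting: a one-species Schwinger family `S₁` on `ℝ⁴` with
`h : OSReconstructionNoE1 S₁.toLabelled`, the contraction semigroup `e^{-tH} = h.transfer t`, the unitary
spatial translations `U(a⃗) = h.translate a` and the joint spectral measures `h.IsJointSpectralMeasure`.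

Main result `isJointSpectralMeasure_integral_smul`: if `μ` is a joint spectral measure of `ψ` and
`w ∈ 𝓢(ℝ⁴)` vanishes on `{a⁰ < 0}`, then the superposed vector `Φ = ∫ w(a) e^{-a⁰H} U(a⃗) ψ da` has the
joint spectral measure `|ŵ|² μ`, where `ŵ(p) = ∫ w(a) e^{-a⁰p₀ + i a⃗·p⃗} da` is the Laplace (time) –
Fourier (space) transform. Proof: `⟪Φ, e^{-tH}U(b⃗)Φ⟫ = ∫∫ w̄(a) w(a') ⟪ψ, e^{-(a⁰+t+a'⁰)H} U(b⃗+a⃗'−a⃗) ψ⟫`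
(self-adjointness of `e^{-sH}`, unitarity of `U`, semigroup and group laws), the inner matrix element
is `∫ e^{-(a⁰+t+a'⁰)p₀ + i(b⃗+a⃗'−a⃗)·p⃗} dμ`, and Fubini factorises the `(a, a')`-integral into
`conj ŵ(p) · ŵ(p)`. Everything else is kernel bookkeeping (`kernel_identity`) and integrability
(`|e^{-a⁰p₀+ia⃗p⃗}| ≤ 1` for `a⁰, p₀ ≥ 0`).

References: K. Osterwalder, R. Schrader, Comm. Math. Phys. 31 (1973) §4.1; M. Reed, B. Simon,
Methods of Modern Mathematical Physics I, Thm. VIII.12. [folklore]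
-/

noncomputable section

namespace Summit.QuantumFields.YangMills.Theorems.NPointIsotropy.ComplexRotationBandlimit

open MeasureTheory Complex Set Filter Topology
open scoped InnerProductSpace ComplexConjugate SchwartzMap ENNReal NNReal
open Literature.MathematicalPhysics.QuantumLattice Literature.MathematicalPhysics.AQFT
  Literature.MathematicalPhysics.QuantumFieldTheory

namespace UniversalTwoPoint

/-! ## The one-point Laplace–Fourier kernel `e^{-a⁰p₀ + i a⃗·p⃗}` -/

/-- `⟪a, p⟫ = a⁰p⁰ + a⃗·p⃗`. [folklore] -/
theorem real_inner_eq_sum (a p : (EuclideanSpace ℝ (Fin 4))) : ⟪a, p⟫_ℝ = a 0 * p 0 + ∑ j : Fin 3, a j.succ * p j.succ := by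
  simp [PiLp.inner_apply, Fin.sum_univ_succ, mul_comm]

/-- `⟪a⃗, p⟫ = a⃗·p⃗` for the spatial part `a⃗ = spatialPart 0 a`. [folklore] -/
theorem inner_spatialPart (v p : (EuclideanSpace ℝ (Fin 4))) : ⟪spatialPart 0 v, p⟫_ℝ = ∑ j : Fin 3, v j.succ * p j.succ := by
  rw [real_inner_eq_sum]
  simp [spatialPart_apply, Fin.succ_ne_zero]

/-- `|e^{-a⁰p₀ + i a⃗·p⃗}| = e^{-a⁰p₀}`. [folklore] -/
theorem norm_kernel (a p : (EuclideanSpace ℝ (Fin 4))) :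
    ‖cexp (-((a 0 * p 0 : ℝ) : ℂ) + ((∑ j : Fin 3, a j.succ * p j.succ : ℝ) : ℂ) * I)‖ =
      Real.exp (-(a 0 * p 0)) := by
  rw [Complex.norm_exp]; congr 1; simp

/-- `|e^{-a⁰p₀ + i a⃗·p⃗}| ≤ 1` for `a⁰ ≥ 0`, `p₀ ≥ 0`. [folklore] -/
theorem norm_kernel_le_one {a p : (EuclideanSpace ℝ (Fin 4))} (ha : 0 ≤ a 0) (hp : 0 ≤ p 0) :
    ‖cexp (-((a 0 * p 0 : ℝ) : ℂ) + ((∑ j : Fin 3, a j.succ * p j.succ : ℝ) : ℂ) * I)‖ ≤ 1 := by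
  rw [norm_kernel, Real.exp_le_one_iff, neg_nonpos]
  exact mul_nonneg ha hp

/-- **Kernel identity**: `e^{-(a⁰+t+a'⁰)p₀ + i(−a⃗+b⃗+a⃗')·p⃗} = conj(e_a(p)) e_{a'}(p) e^{-tp₀ + i⟨b,p⟩}` for
spatial `b`. [folklore] -/
theorem kernel_identity (a a' b p : (EuclideanSpace ℝ (Fin 4))) (hb : b 0 = 0) (t : ℝ) :
    cexp ((((-((a 0 + t + a' 0) * p 0)) : ℝ) : ℂ) +
        ((⟪spatialPart 0 (-a + b + a'), p⟫_ℝ : ℝ) : ℂ) * I) =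
      conj (cexp (-((a 0 * p 0 : ℝ) : ℂ) + ((∑ j : Fin 3, a j.succ * p j.succ : ℝ) : ℂ) * I)) *
        cexp (-((a' 0 * p 0 : ℝ) : ℂ) + ((∑ j : Fin 3, a' j.succ * p j.succ : ℝ) : ℂ) * I) *
        cexp ((((-(t * p 0)) : ℝ) : ℂ) + ((⟪b, p⟫_ℝ : ℝ) : ℂ) * I) := by
  rw [inner_spatialPart, real_inner_eq_sum b p, hb, zero_mul, zero_add, ← Complex.exp_conj,
    ← Complex.exp_add, ← Complex.exp_add]
  congr 1
  have hs : ∀ j : Fin 3, (-a + b + a') j.succ * p j.succ =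
      -(a j.succ * p j.succ) + b j.succ * p j.succ + a' j.succ * p j.succ := by
    intro j; simp only [PiLp.add_apply, PiLp.neg_apply]; ring
  simp only [hs, Finset.sum_add_distrib, Finset.sum_neg_distrib, map_add, map_neg, map_mul,
    Complex.conj_ofReal, Complex.conj_I]
  push_cast
  ring

/-- **The transform is bounded by the `L¹` norm of the weight** on `{p₀ ≥ 0}`, for weights vanishing on
`{a⁰ < 0}`: `|ŵ(p)| ≤ ∫ |w|`. [folklore] -/
theorem norm_transform_le (w : 𝓢((EuclideanSpace ℝ (Fin 4)), ℂ)) (hw : ∀ a, w a ≠ 0 → 0 ≤ a 0) {p : (EuclideanSpace ℝ (Fin 4))} (hp : 0 ≤ p 0) :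
    ‖∫ a, w a * cexp (-((a 0 * p 0 : ℝ) : ℂ) + ((∑ j : Fin 3, a j.succ * p j.succ : ℝ) : ℂ) * I)‖ ≤
      ∫ a, ‖w a‖ := by
  refine norm_integral_le_of_norm_le w.integrable.norm (Eventually.of_forall fun a => ?_)
  rw [norm_mul]
  by_cases hwa : w a = 0
  · simp [hwa]
  · exact mul_le_of_le_one_right (norm_nonneg _) (norm_kernel_le_one (hw a hwa) hp)

/-- The transform `p ↦ ŵ(p)` is measurable (a parameter integral of a continuous kernel). [folklore] -/
theorem measurable_transform (w : 𝓢((EuclideanSpace ℝ (Fin 4)), ℂ)) :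
    Measurable fun p : (EuclideanSpace ℝ (Fin 4)) =>
      ∫ a, w a * cexp (-((a 0 * p 0 : ℝ) : ℂ) + ((∑ j : Fin 3, a j.succ * p j.succ : ℝ) : ℂ) * I) := by
  have hw : Continuous (w : (EuclideanSpace ℝ (Fin 4)) → ℂ) := w.continuous
  have hc : Continuous fun q : (EuclideanSpace ℝ (Fin 4)) × (EuclideanSpace ℝ (Fin 4)) =>
      w q.2 * cexp (-((q.2 0 * q.1 0 : ℝ) : ℂ) + ((∑ j : Fin 3, q.2 j.succ * q.1 j.succ : ℝ) : ℂ) * I) := by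
    fun_prop
  exact (hc.stronglyMeasurable.integral_prod_right' (ν := volume)).measurable

/-- The density `p ↦ |ŵ(p)|²` (as an `ℝ≥0∞`-valued function) is measurable. [folklore] -/
theorem measurable_ofReal_norm_transform_sq (w : 𝓢((EuclideanSpace ℝ (Fin 4)), ℂ)) :
    Measurable fun p : (EuclideanSpace ℝ (Fin 4)) => ENNReal.ofReal
      (‖∫ a, w a * cexp (-((a 0 * p 0 : ℝ) : ℂ) +
        ((∑ j : Fin 3, a j.succ * p j.succ : ℝ) : ℂ) * I)‖ ^ 2) :=
  ((measurable_transform w).norm.pow_const 2).ennreal_ofReal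

/-! ## Fubini: the double weighted integral of the kernel matrix elements -/

/-- **Fubini factorisation.** For a finite measure `μ` carried by `{p₀ ≥ 0}`, a weight `w ∈ 𝓢(ℝ⁴)`
vanishing on `{a⁰ < 0}`, `t ≥ 0`, a spatial `b`, and any `G(a, a')` which on the support of `w ⊗ w`
equals `∫ conj(e_a) e_{a'} e_{t,b} dμ`:
`∫ w(a') ∫ w̄(a) G(a, a') da da' = ∫ |ŵ(p)|² e^{-tp₀ + i⟨b,p⟩} dμ(p)`. [folklore] -/
theorem integral_integral_kernel {μ : Measure (EuclideanSpace ℝ (Fin 4))} [IsFiniteMeasure μ] (hμ : μ {p | p 0 < 0} = 0)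
    (w : 𝓢((EuclideanSpace ℝ (Fin 4)), ℂ)) (hw : ∀ a, w a ≠ 0 → 0 ≤ a 0) {t : ℝ} (ht : 0 ≤ t) (b : (EuclideanSpace ℝ (Fin 4))) (G : (EuclideanSpace ℝ (Fin 4)) → (EuclideanSpace ℝ (Fin 4)) → ℂ)
    (hG : ∀ a a', w a ≠ 0 → w a' ≠ 0 → G a a' =
      ∫ p, conj (cexp (-((a 0 * p 0 : ℝ) : ℂ) + ((∑ j : Fin 3, a j.succ * p j.succ : ℝ) : ℂ) * I)) *
        cexp (-((a' 0 * p 0 : ℝ) : ℂ) + ((∑ j : Fin 3, a' j.succ * p j.succ : ℝ) : ℂ) * I) *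
        cexp ((((-(t * p 0)) : ℝ) : ℂ) + ((⟪b, p⟫_ℝ : ℝ) : ℂ) * I) ∂μ) :
    (∫ a', w a' * ∫ a, conj (w a) * G a a') =
      ∫ p, ((‖∫ a, w a * cexp (-((a 0 * p 0 : ℝ) : ℂ) +
          ((∑ j : Fin 3, a j.succ * p j.succ : ℝ) : ℂ) * I)‖ ^ 2 : ℝ) : ℂ) *
        cexp ((((-(t * p 0)) : ℝ) : ℂ) + ((⟪b, p⟫_ℝ : ℝ) : ℂ) * I) ∂μ := by
  -- the triple integrand `Λ((a', a), p) = w̄(a) w(a') conj(e_a(p)) e_{a'}(p) e_{t,b}(p)`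
  set Λ : ((EuclideanSpace ℝ (Fin 4)) × (EuclideanSpace ℝ (Fin 4))) × (EuclideanSpace ℝ (Fin 4)) → ℂ := fun q =>
    conj (w q.1.2) * w q.1.1 *
      (conj (cexp (-((q.1.2 0 * q.2 0 : ℝ) : ℂ) + ((∑ j : Fin 3, q.1.2 j.succ * q.2 j.succ : ℝ) : ℂ) * I)) *
        cexp (-((q.1.1 0 * q.2 0 : ℝ) : ℂ) + ((∑ j : Fin 3, q.1.1 j.succ * q.2 j.succ : ℝ) : ℂ) * I) *
        cexp ((((-(t * q.2 0)) : ℝ) : ℂ) + ((⟪b, q.2⟫_ℝ : ℝ) : ℂ) * I)) with hΛ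
  have hwc : Continuous (w : (EuclideanSpace ℝ (Fin 4)) → ℂ) := w.continuous
  have hΛc : Continuous Λ := by
    rw [hΛ]
    fun_prop
  -- integrability on the triple product
  have hdom : Integrable (fun q : ((EuclideanSpace ℝ (Fin 4)) × (EuclideanSpace ℝ (Fin 4))) × (EuclideanSpace ℝ (Fin 4)) => (‖w q.1.1‖ * ‖w q.1.2‖) * (1 : ℝ))
      (((volume : Measure (EuclideanSpace ℝ (Fin 4))).prod (volume : Measure (EuclideanSpace ℝ (Fin 4)))).prod μ) :=
    ((w.integrable (μ := (volume : Measure (EuclideanSpace ℝ (Fin 4))))).norm.mul_prod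
      (w.integrable (μ := (volume : Measure (EuclideanSpace ℝ (Fin 4))))).norm).mul_prod (integrable_const (μ := μ) (1 : ℝ))
  have hae : ∀ᵐ q ∂((volume : Measure (EuclideanSpace ℝ (Fin 4))).prod (volume : Measure (EuclideanSpace ℝ (Fin 4)))).prod μ, 0 ≤ q.2 0 := by
    have h0 : ((volume : Measure (EuclideanSpace ℝ (Fin 4))).prod (volume : Measure (EuclideanSpace ℝ (Fin 4)))).prod μ (univ ×ˢ {p : (EuclideanSpace ℝ (Fin 4)) | p 0 < 0}) = 0 := by
      rw [Measure.prod_prod, hμ, mul_zero]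
    filter_upwards [measure_eq_zero_iff_ae_notMem.1 h0] with q hq
    simp only [mem_prod, mem_univ, mem_setOf_eq, true_and, not_lt] at hq
    exact hq
  have hΛi : Integrable Λ (((volume : Measure (EuclideanSpace ℝ (Fin 4))).prod (volume : Measure (EuclideanSpace ℝ (Fin 4)))).prod μ) := by
    refine hdom.mono' hΛc.aestronglyMeasurable ?_
    filter_upwards [hae] with q hq
    rw [mul_one]
    by_cases h1 : w q.1.1 = 0
    · simp [hΛ, h1]
    by_cases h2 : w q.1.2 = 0
    · simp [hΛ, h2]
    have e1 := norm_kernel_le_one (hw _ h1) hq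
    have e2 := norm_kernel_le_one (hw _ h2) hq
    have e3 : ‖cexp ((((-(t * q.2 0)) : ℝ) : ℂ) + ((⟪b, q.2⟫_ℝ : ℝ) : ℂ) * I)‖ ≤ 1 := by
      rw [OSReconstructionNoE1.norm_jointSpectralKernel, Real.exp_le_one_iff, neg_nonpos]
      exact mul_nonneg ht hq
    simp only [hΛ, norm_mul, RCLike.norm_conj]
    have h3 : 0 ≤ ‖w q.1.1‖ * ‖w q.1.2‖ := by positivity
    calc ‖w q.1.2‖ * ‖w q.1.1‖ * (‖cexp (-((q.1.2 0 * q.2 0 : ℝ) : ℂ) +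
            ((∑ j : Fin 3, q.1.2 j.succ * q.2 j.succ : ℝ) : ℂ) * I)‖ *
          ‖cexp (-((q.1.1 0 * q.2 0 : ℝ) : ℂ) + ((∑ j : Fin 3, q.1.1 j.succ * q.2 j.succ : ℝ) : ℂ) * I)‖ *
          ‖cexp ((((-(t * q.2 0)) : ℝ) : ℂ) + ((⟪b, q.2⟫_ℝ : ℝ) : ℂ) * I)‖)
        ≤ ‖w q.1.2‖ * ‖w q.1.1‖ * (1 * 1 * 1) := by
          gcongr
      _ = ‖w q.1.1‖ * ‖w q.1.2‖ := by ring
  -- step 1: the pointwise identity `w(a') ∫ w̄(a) G = ∫_a ∫_p Λ`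
  have hpt : ∀ a', w a' * ∫ a, conj (w a) * G a a' = ∫ a, ∫ p, Λ ((a', a), p) ∂μ := by
    intro a'
    rw [← integral_const_mul]
    refine integral_congr_ae (Eventually.of_forall fun a => ?_)
    by_cases h1 : w a' = 0
    · simp [hΛ, h1]
    by_cases h2 : w a = 0
    · simp [hΛ, h2]
    beta_reduce
    rw [hG a a' h2 h1, ← integral_const_mul, ← integral_const_mul]
    refine integral_congr_ae (Eventually.of_forall fun p => ?_)
    simp only [hΛ]
    ring
  simp_rw [hpt]
  -- step 2: iterated `(a', a)` integral as a product integral, and swap with `p`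
  rw [integral_integral (f := fun a' a => ∫ p, Λ ((a', a), p) ∂μ) hΛi.integral_prod_left,
    integral_integral_swap (f := fun z p => Λ (z, p)) hΛi]
  -- step 3: the inner `(a', a)` integral factorises
  refine integral_congr_ae (Eventually.of_forall fun p => ?_)
  have hfac : (fun z : (EuclideanSpace ℝ (Fin 4)) × (EuclideanSpace ℝ (Fin 4)) => Λ (z, p)) = fun z =>
      (w z.1 * cexp (-((z.1 0 * p 0 : ℝ) : ℂ) + ((∑ j : Fin 3, z.1 j.succ * p j.succ : ℝ) : ℂ) * I)) *
        conj (w z.2 * cexp (-((z.2 0 * p 0 : ℝ) : ℂ) +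
          ((∑ j : Fin 3, z.2 j.succ * p j.succ : ℝ) : ℂ) * I)) *
        cexp ((((-(t * p 0)) : ℝ) : ℂ) + ((⟪b, p⟫_ℝ : ℝ) : ℂ) * I) := by
    funext z
    simp only [hΛ, map_mul]
    ring
  simp only [] at hfac ⊢
  rw [hfac, integral_mul_const,
    integral_prod_mul (f := fun a' : (EuclideanSpace ℝ (Fin 4)) => w a' * cexp (-((a' 0 * p 0 : ℝ) : ℂ) +
      ((∑ j : Fin 3, a' j.succ * p j.succ : ℝ) : ℂ) * I))
      (g := fun a : (EuclideanSpace ℝ (Fin 4)) => conj (w a * cexp (-((a 0 * p 0 : ℝ) : ℂ) +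
        ((∑ j : Fin 3, a j.succ * p j.succ : ℝ) : ℂ) * I))),
    integral_conj, Complex.mul_conj']
  push_cast
  rfl

/-! ## The operator side: matrix elements of translated vectors -/

variable {S₁ : SchwingerFamily (EuclideanSpace ℝ (Fin 4))} (h : OSReconstructionNoE1 S₁.toLabelled)

/-- `⟪U(a⃗)ψ, φ⟫ = ⟪ψ, U(−a⃗)φ⟫`. [folklore] -/
theorem inner_translate_left (a : (EuclideanSpace ℝ (Fin 4))) (ψ φ : h.Hilbert) :
    ⟪h.translate a ψ, φ⟫_ℂ = ⟪ψ, h.translate (-a) φ⟫_ℂ := by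
  conv_lhs => rw [← LinearIsometryEquiv.inner_map_map (h.translate (-a)) (h.translate a ψ) φ,
    ← h.translate_add_apply, neg_add_cancel, h.translate_zero_apply]

/-- **Matrix elements of translated vectors**:
`⟪e^{-a⁰H}U(a⃗)ψ, e^{-tH}U(b⃗)e^{-a'⁰H}U(a⃗')ψ⟫ = ⟪ψ, e^{-(a⁰+t+a'⁰)H} U(−a⃗+b⃗+a⃗') ψ⟫` for
`a⁰, t, a'⁰ ≥ 0`. [folklore] -/
theorem inner_transfer_translate_pair (ψ : h.Hilbert) {a a' : (EuclideanSpace ℝ (Fin 4))} (ha : 0 ≤ a 0) (ha' : 0 ≤ a' 0)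
    {t : ℝ} (ht : 0 ≤ t) (b : (EuclideanSpace ℝ (Fin 4))) :
    ⟪h.transfer (a 0) (h.translate a ψ),
        h.transfer t (h.translate b (h.transfer (a' 0) (h.translate a' ψ)))⟫_ℂ =
      ⟪ψ, h.transfer (a 0 + t + a' 0) (h.translate (spatialPart 0 (-a + b + a')) ψ)⟫_ℂ := by
  rw [h.inner_transfer_left, h.translate_transfer b (a' 0), ← h.translate_add_apply,
    ← ContinuousLinearMap.comp_apply (h.transfer t), ← h.transfer_add ht ha',
    ← ContinuousLinearMap.comp_apply (h.transfer (a 0)), ← h.transfer_add ha (add_nonneg ht ha'),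
    inner_translate_left, h.translate_transfer, ← h.translate_add_apply, h.translate_spatialPart,
    add_assoc, add_assoc]

/-! ## The joint spectral measure of a superposed vector -/

/-- **The joint spectral measure of a superposed vector.** If `μ` is a joint spectral measure of `ψ`
and the Schwartz weight `w` vanishes on `{a⁰ < 0}` (with `a ↦ w(a) e^{-a⁰H} U(a⃗) ψ` Bochner integrable,
as it always is), then `|ŵ|² μ` is a joint spectral measure of `∫ w(a) e^{-a⁰H} U(a⃗) ψ da`,
`ŵ(p) = ∫ w(a) e^{-a⁰p₀ + ia⃗·p⃗} da`. [folklore] -/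
theorem isJointSpectralMeasure_integral_smul (ψ : h.Hilbert) {μ : Measure (EuclideanSpace ℝ (Fin 4))}
    (hμ : h.IsJointSpectralMeasure ψ μ) (w : 𝓢((EuclideanSpace ℝ (Fin 4)), ℂ)) (hw : ∀ a, w a ≠ 0 → 0 ≤ a 0)
    (hint : Integrable fun a : (EuclideanSpace ℝ (Fin 4)) => w a • h.transfer (a 0) (h.translate a ψ)) :
    h.IsJointSpectralMeasure (∫ a, w a • h.transfer (a 0) (h.translate a ψ))
      (μ.withDensity fun p => ENNReal.ofReal
        (‖∫ a, w a * cexp (-((a 0 * p 0 : ℝ) : ℂ) +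
          ((∑ j : Fin 3, a j.succ * p j.succ : ℝ) : ℂ) * I)‖ ^ 2)) := by
  haveI := hμ.isFiniteMeasure
  have hp0 : ∀ᵐ p ∂μ, 0 ≤ p 0 := LaplaceFourierHalfSpace.ae_nonneg_apply_zero μ hμ.energy_nonneg
  set V : (EuclideanSpace ℝ (Fin 4)) → h.Hilbert := fun a => h.transfer (a 0) (h.translate a ψ) with hV
  replace hint : Integrable (fun a => w a • V a) := hint
  refine ⟨?_, ?_, fun t ht b hb => ?_⟩
  · -- finiteness: the density is bounded by `(∫ |w|)²` on `{p₀ ≥ 0}`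
    refine isFiniteMeasure_withDensity_ofReal ?_
    refine ((integrable_const ((∫ a, ‖w a‖) ^ 2)).mono'
      ((measurable_transform w).norm.pow_const 2).aestronglyMeasurable ?_).hasFiniteIntegral
    filter_upwards [hp0] with p hp
    rw [Real.norm_of_nonneg (sq_nonneg _)]
    exact pow_le_pow_left₀ (norm_nonneg _) (norm_transform_le w hw hp) 2
  · exact withDensity_absolutelyContinuous μ _ hμ.energy_nonneg
  · -- the Laplace–Fourier representation
    set W : h.Hilbert →L[ℂ] h.Hilbert :=
      (h.transfer t).comp ((h.translate b).toContinuousLinearEquiv : h.Hilbert →L[ℂ] h.Hilbert)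
    have hWapp : ∀ x, W x = h.transfer t (h.translate b x) := fun x => rfl
    have hint2 : Integrable (fun a' => w a' • W (V a')) := by
      have := hint.norm.mul_const ‖W‖
      refine (this.const_mul 1).mono' ?_ (Eventually.of_forall fun a' => ?_)
      · exact (W.continuous.comp_aestronglyMeasurable hint.aestronglyMeasurable).congr
          (Eventually.of_forall fun a' => by simp [map_smul])
      · rw [norm_smul, one_mul, norm_smul, mul_assoc]
        gcongr
        rw [mul_comm]
        exact W.le_opNorm _
    have h1 : h.transfer t (h.translate b (∫ a, w a • V a)) = ∫ a', w a' • W (V a') := by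
      rw [← hWapp, ← W.integral_comp_comm hint]
      simp only [map_smul]
    rw [h1, ← integral_inner hint2]
    have h2 : ∀ a', ⟪∫ a, w a • V a, w a' • W (V a')⟫_ℂ = w a' * ∫ a, conj (w a) * ⟪V a, W (V a')⟫_ℂ := by
      intro a'
      rw [inner_smul_right, ← inner_conj_symm, ← integral_inner hint, ← integral_conj]
      congr 1
      refine integral_congr_ae (Eventually.of_forall fun a => ?_)
      show conj ⟪W (V a'), w a • V a⟫_ℂ = conj (w a) * ⟪V a, W (V a')⟫_ℂ
      rw [inner_smul_right, map_mul, inner_conj_symm]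
    rw [integral_congr_ae (Eventually.of_forall h2)]
    rw [integral_integral_kernel hμ.energy_nonneg w hw ht b (fun a a' => ⟪V a, W (V a')⟫_ℂ) ?_,
      integral_withDensity_eq_integral_toReal_smul (measurable_ofReal_norm_transform_sq w)
        (Eventually.of_forall fun p => ENNReal.ofReal_lt_top)]
    · refine integral_congr_ae (Eventually.of_forall fun p => ?_)
      beta_reduce
      rw [ENNReal.toReal_ofReal (sq_nonneg _), Complex.real_smul]
    · intro a a' ha ha'
      rw [hWapp, hV]
      rw [inner_transfer_translate_pair h ψ (hw a ha) (hw a' ha') ht b,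
        hμ.inner_transfer_translate _ (add_nonneg (add_nonneg (hw a ha) ht) (hw a' ha')) _
          (OSReconstructionNoE1.spatialPart_zero_apply_zero _)]
      refine integral_congr_ae (Eventually.of_forall fun p => ?_)
      exact kernel_identity a a' b p hb t

end UniversalTwoPoint

/-- **The joint spectral measure of a superposed vector** (closed form of
`UniversalTwoPoint.isJointSpectralMeasure_integral_smul`, the registered sub-goal of this support file):
`|ŵ|² μ` is a joint spectral measure of `∫ w(a) e^{-a⁰H} U(a⃗) ψ da` whenever `μ` is one of `ψ` and the Schwartz
weight `w` vanishes on `{a⁰ < 0}`. [folklore] -/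
theorem superposedVector_isJointSpectralMeasure : ∀ (S₁ : Literature.MathematicalPhysics.QuantumLattice.SchwingerFamily (EuclideanSpace ℝ (Fin 4))) (h : Literature.MathematicalPhysics.QuantumFieldTheory.OSReconstructionNoE1 S₁.toLabelled) (ψ : h.Hilbert) (μ : MeasureTheory.Measure (EuclideanSpace ℝ (Fin 4))), h.IsJointSpectralMeasure ψ μ → ∀ (w : SchwartzMap (EuclideanSpace ℝ (Fin 4)) ℂ), (∀ a : EuclideanSpace ℝ (Fin 4), w a ≠ 0 → 0 ≤ a 0) → MeasureTheory.Integrable (fun a : EuclideanSpace ℝ (Fin 4) => w a • h.transfer (a 0) (h.translate a ψ)) → h.IsJointSpectralMeasure (∫ a : EuclideanSpace ℝ (Fin 4), w a • h.transfer (a 0) (h.translate a ψ)) (μ.withDensity fun p : EuclideanSpace ℝ (Fin 4) => ENNReal.ofReal (‖∫ a : EuclideanSpace ℝ (Fin 4), w a * Complex.exp (-((a 0 * p 0 : ℝ) : ℂ) + ((∑ j : Fin 3, a j.succ * p j.succ : ℝ) : ℂ) * Complex.I)‖ ^ 2)) :=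
  fun _ h ψ _ hμ w hw hint => UniversalTwoPoint.isJointSpectralMeasure_integral_smul h ψ hμ w hw hint

end Summit.QuantumFields.YangMills.Theorems.NPointIsotropy.ComplexRotationBandlimit

end
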